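import Summits.AtomisticToContinuum.HydrodynamicLimit.Theses.AntiMazurCoboundaries
import Literature.MathematicalPhysics.KineticTheory.HardSphereEulerProofs
import Literature.MathematicalPhysics.KineticTheory.HardBallErgodicity
import Literature.Probability.Distributions.GaussianMaxwellBorel
import Literature.Probability.Distributions.GaussianHelmert

/-!
# Stub `stub_gaussianShellMarginal` of line `almost-invariant-duality` — crux `AntiMazurCoboundaries.CorrectorPressureDecay`
(stmt-AtomisticToContinuum-14135)

Helper file (`--supports stmt-AtomisticToContinuum-14135`) proving the registered stub `stub_gaussianShellMarginal` of the lead's skeleton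
`Cruxes/CorrectorPressureDecay/Lines/almost-invariant-duality.lean`: the Maxwell–Borel / Diaconis–Freedman estimate in Gaussian
testing form — for `n = N+1` i.i.d. standard Gaussian vectors `wᵢ ∈ ℝ³` and the conserved pair `(P, T) = (∑wᵢ, ∑‖wᵢ‖²)`,
`|E[(h(w₀) − M_h(P,T)) B(P,T)]| ≤ (C₁/n) E[B(P,T)]` with the Maxwellian average `M_h(P,T) = ∫ h(P/n + √θ̂′ u) dγ₃(u)`,
`θ̂′ = (T/n − ‖P/n‖²)/3`, uniformly over measurable `|h| ≤ 1` and bounded measurable `B ≥ 0`; here `C₁ = 542`. Proof summary: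
* `n ≤ 2`: the trivial bound `|h − M_h| ≤ 2` (`abs_sub_integral_le_two`).
* `n ≥ 3`: the Helmert decomposition `Literature.Probability.Distributions.exists_gaussian_helmert` writes `⊗ⁿγ₃` as the image of
  `γ₃ ⊗ γ₃ ⊗ γ_{ℝ^{3n−6}}` in the variables `(c, x, z)` = (rescaled mean, rescaled fluctuation of `w₀`, remaining fluctuations), with
  `P = √n c`, `w₀ = c/√n + √(N/n) x`, `T = ‖c‖² + ‖x‖² + ‖z‖²`, so that `M_h` becomes the Gaussian average at variance `Q/(3n)`,
  `Q = ‖x‖² + ‖z‖²`; Fubini over `c` and, at fixed `c`, the Maxwell–Borel lemma in testing form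
  `Literature.Probability.Distributions.abs_integral_sub_gaussianAverage_mul_le` (Diaconis–Freedman rate `2·271/(3N)`, from
  `tvClose_sphereMarginal_stdGaussian` and the independence `map_sphereMarginalMap_normSq_eq_prod`); finally `542/(3N) ≤ 542/(N+1)`.
-/

noncomputable section

open MeasureTheory ProbabilityTheory Set Filter Topology
open scoped ENNReal

namespace Summit.AtomisticToContinuum.HydrodynamicLimit.Theorems.AlmostInvariantDuality

open Literature.MathematicalPhysics.KineticTheory (T3 V3 hsDiameter localGibbsLaw)
open Literature.Analysis.FluidPDE (HardSphereFlow Config configMomentum configEnergy)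
open Summit.AtomisticToContinuum.HydrodynamicLimit.Theses.AntiMazurCoboundaries (CorrectorPressureDecay)
open Literature.Probability.Distributions (exists_gaussian_helmert abs_integral_sub_gaussianAverage_mul_le)
open Module

/-- The trivial bound behind the small-`n` case and the integrability estimates: for `|h| ≤ 1` and a probability measure,
`|h(v) − ∫ h ∘ φ dμ| ≤ 2`. -/
theorem abs_sub_integral_le_two {α : Type*} [MeasurableSpace α] (μ : Measure α) [IsProbabilityMeasure μ] {h : V3 → ℝ}
    (hh1 : ∀ v, |h v| ≤ 1) (v : V3) (φ : α → V3) : |h v - ∫ u, h (φ u) ∂μ| ≤ 2 := by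
  have i2 : ‖∫ u, h (φ u) ∂μ‖ ≤ 1 * μ.real univ :=
    norm_integral_le_of_norm_le_const (ae_of_all _ fun u => by rw [Real.norm_eq_abs]; exact hh1 _)
  rw [probReal_univ, mul_one, Real.norm_eq_abs] at i2
  calc |h v - ∫ u, h (φ u) ∂μ| ≤ |h v| + |∫ u, h (φ u) ∂μ| := abs_sub _ _
    _ ≤ 1 + 1 := add_le_add (hh1 v) i2
    _ = 2 := by norm_num

/-- STUB 3b-i (size XL; TRUE — Diaconis–Freedman / Maxwell–Borel in Gaussian testing form; see `GaussianShellMarginal`).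
Template in the tree: the complex-coordinates version `Literature.Probability.RandomMatrix.tvClose_sphereTrunc`
(`SphereTruncationTV.lean`, via `UnitaryInvariantPolar.tvClose_of_unitaryInvariant`, `SphereCoordinateDensity`,
`Distributions.tvClose_betaGammaRatio`) and the TV toolkit `Literature.MeasureTheory.TotalVariation` (`TVClose`,
`TVClose.abs_integral_sub_le`, `tvClose_of_forall_le_add`, `tvClose_withDensity_of_le`). Sources: Diaconis–Freedman,
Ann. IHP B 23 (1987) 397–423, Thm 1; Mehler / Maxwell–Borel lemma. -/
theorem stub_gaussianShellMarginal :
    ∃ C₁ : ℝ, 0 ≤ C₁ ∧ ∀ (N : ℕ) (h : V3 → ℝ), Measurable h → (∀ v, |h v| ≤ 1) →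
      ∀ B : V3 → ℝ → ℝ, Measurable (fun p : V3 × ℝ => B p.1 p.2) → (∀ p t, 0 ≤ B p t) →
        (∃ C : ℝ, ∀ p t, B p t ≤ C) →
        |∫ w, (h (w 0) -
              (∫ u, h ((((N : ℝ) + 1))⁻¹ • (∑ i, w i) +
                Real.sqrt (((((N : ℝ) + 1))⁻¹ * (∑ i, ‖w i‖ ^ 2) - ‖(((N : ℝ) + 1))⁻¹ • (∑ i, w i)‖ ^ 2) / 3) • u)
                ∂(stdGaussian V3))) *
              B (∑ i, w i) (∑ i, ‖w i‖ ^ 2) ∂(Measure.pi fun _ : Fin (N + 1) => stdGaussian V3)| ≤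
          C₁ / ((N : ℝ) + 1) * ∫ w, B (∑ i, w i) (∑ i, ‖w i‖ ^ 2) ∂(Measure.pi fun _ : Fin (N + 1) => stdGaussian V3) := by
  refine ⟨542, by norm_num, ?_⟩
  intro N h hh hh1 B hB hB0 hBC
  obtain ⟨CB, hCB⟩ := hBC
  have hn0 : (0 : ℝ) < (N : ℝ) + 1 := by positivity
  -- integrability of the weight
  have hPm : Measurable fun w : Fin (N + 1) → V3 => ∑ i, w i :=
    Finset.measurable_sum _ fun i _ => measurable_pi_apply i
  have hTm' : Measurable fun w : Fin (N + 1) → V3 => ∑ i, ‖w i‖ ^ 2 :=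
    Finset.measurable_sum _ fun i _ => (measurable_pi_apply i).norm.pow_const 2
  have hBw : Measurable fun w : Fin (N + 1) → V3 => B (∑ i, w i) (∑ i, ‖w i‖ ^ 2) :=
    hB.comp (hPm.prodMk hTm')
  have hBi : Integrable (fun w : Fin (N + 1) → V3 => B (∑ i, w i) (∑ i, ‖w i‖ ^ 2))
      (Measure.pi fun _ : Fin (N + 1) => stdGaussian V3) :=
    Integrable.of_bound hBw.aestronglyMeasurable CB (ae_of_all _ fun w => by
      rw [Real.norm_eq_abs, abs_of_nonneg (hB0 _ _)]; exact hCB _ _)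
  rcases lt_or_ge N 2 with hN | hN
  · -- small `n`: the trivial bound `2 ≤ 542/(N+1)`
    refine abs_integral_le_integral_abs.trans ?_
    refine (integral_mono_of_nonneg (ae_of_all _ fun w => abs_nonneg _) (hBi.const_mul 2)
      (ae_of_all _ fun w => ?_)).trans ?_
    · dsimp only
      rw [abs_mul, abs_of_nonneg (hB0 _ _)]
      exact mul_le_mul_of_nonneg_right (abs_sub_integral_le_two _ hh1 _ _) (hB0 _ _)
    · rw [integral_const_mul]
      refine mul_le_mul_of_nonneg_right ?_ (integral_nonneg fun w => hB0 _ _)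
      rw [le_div_iff₀ hn0]
      have : (N : ℝ) ≤ 1 := by exact_mod_cast (by omega : N ≤ 1)
      linarith
  -- `n ≥ 3`: Helmert reduction + Maxwell–Borel
  have hN1 : 1 ≤ N := by omega
  have hN0 : (N : ℝ) ≠ 0 := by exact_mod_cast (by omega : N ≠ 0)
  have hsq : 0 < Real.sqrt ((N : ℝ) + 1) := Real.sqrt_pos.2 hn0
  obtain ⟨T, hTm, hTlaw, hTid⟩ := exists_gaussian_helmert (V := V3) N hN1
  have hF3 : 3 ≤ finrank ℝ (EuclideanSpace ℝ (Fin ((N - 1) * finrank ℝ V3))) := by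
    simp only [finrank_euclideanSpace_fin]
    omega
  set a : ℝ := Real.sqrt N / Real.sqrt ((N : ℝ) + 1) with ha
  set d : ℝ := ((finrank ℝ V3 + finrank ℝ (EuclideanSpace ℝ (Fin ((N - 1) * finrank ℝ V3))) : ℕ) : ℝ) with hd_def
  have hd : d = 3 * N := by
    rw [hd_def]
    simp only [finrank_euclideanSpace_fin]
    push_cast [Nat.cast_sub hN1]
    ring
  set Ck : ℝ := (finrank ℝ V3 : ℝ) * (finrank ℝ V3 + 2) + 32 * 2 ^ finrank ℝ V3 with hCk_def
  have hCk : Ck = 271 := by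
    rw [hCk_def]
    simp only [finrank_euclideanSpace_fin]
    norm_num
  have hconst : 2 * (Ck / d) ≤ 542 / ((N : ℝ) + 1) := by
    rw [hCk, hd, show (2 : ℝ) * (271 / (3 * N)) = 542 / (3 * N) by ring,
      div_le_div_iff₀ (by positivity) hn0]
    have : (2 : ℝ) ≤ N := by exact_mod_cast hN
    nlinarith
  -- the integrands in the Helmert variables `y = (c, (x, z))`
  set Φt : V3 × V3 × EuclideanSpace ℝ (Fin ((N - 1) * finrank ℝ V3)) → ℝ := fun y =>
    (h ((Real.sqrt ((N : ℝ) + 1))⁻¹ • y.1 + a • y.2.1) -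
      ∫ u, h ((Real.sqrt ((N : ℝ) + 1))⁻¹ • y.1 +
        a • (Real.sqrt ((‖y.2.1‖ ^ 2 + ‖y.2.2‖ ^ 2) / d) • u)) ∂(stdGaussian V3)) *
      B (Real.sqrt ((N : ℝ) + 1) • y.1) (‖y.1‖ ^ 2 + (‖y.2.1‖ ^ 2 + ‖y.2.2‖ ^ 2)) with hΦt
  set Bt : V3 × V3 × EuclideanSpace ℝ (Fin ((N - 1) * finrank ℝ V3)) → ℝ := fun y =>
    B (Real.sqrt ((N : ℝ) + 1) • y.1) (‖y.1‖ ^ 2 + (‖y.2.1‖ ^ 2 + ‖y.2.2‖ ^ 2)) with hBt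
  have hBt_meas : Measurable Bt := by
    rw [hBt]
    exact hB.comp (f := fun y : V3 × V3 × EuclideanSpace ℝ (Fin ((N - 1) * finrank ℝ V3)) =>
      (Real.sqrt ((N : ℝ) + 1) • y.1, ‖y.1‖ ^ 2 + (‖y.2.1‖ ^ 2 + ‖y.2.2‖ ^ 2))) (by fun_prop)
  have hΦt_meas : Measurable Φt := by
    have h1 : Measurable fun y : V3 × V3 × EuclideanSpace ℝ (Fin ((N - 1) * finrank ℝ V3)) =>
        h ((Real.sqrt ((N : ℝ) + 1))⁻¹ • y.1 + a • y.2.1) := hh.comp (by fun_prop)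
    have hu : Measurable fun yu : (V3 × V3 × EuclideanSpace ℝ (Fin ((N - 1) * finrank ℝ V3))) × V3 =>
        h ((Real.sqrt ((N : ℝ) + 1))⁻¹ • yu.1.1 +
          a • (Real.sqrt ((‖yu.1.2.1‖ ^ 2 + ‖yu.1.2.2‖ ^ 2) / d) • yu.2)) := hh.comp (by fun_prop)
    have h2 := (hu.stronglyMeasurable.integral_prod_right' (ν := stdGaussian V3)).measurable
    rw [hΦt]
    exact (h1.sub h2).mul hBt_meas
  have hΦt_bdd : ∀ y, ‖Φt y‖ ≤ 2 * CB := fun y => by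
    rw [hΦt, Real.norm_eq_abs]
    dsimp only
    rw [abs_mul, abs_of_nonneg (hB0 _ _)]
    exact mul_le_mul (abs_sub_integral_le_two _ hh1 _ _) (hCB _ _) (hB0 _ _) (by norm_num)
  have hBt_bdd : ∀ y, ‖Bt y‖ ≤ CB := fun y => by
    rw [hBt, Real.norm_eq_abs]
    dsimp only
    rw [abs_of_nonneg (hB0 _ _)]
    exact hCB _ _
  have hΦt_int : Integrable Φt ((stdGaussian V3).prod ((stdGaussian V3).prod
      (stdGaussian (EuclideanSpace ℝ (Fin ((N - 1) * finrank ℝ V3)))))) :=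
    (integrable_const (2 * CB)).mono' hΦt_meas.aestronglyMeasurable (ae_of_all _ hΦt_bdd)
  have hBt_int : Integrable Bt ((stdGaussian V3).prod ((stdGaussian V3).prod
      (stdGaussian (EuclideanSpace ℝ (Fin ((N - 1) * finrank ℝ V3)))))) :=
    (integrable_const CB).mono' hBt_meas.aestronglyMeasurable (ae_of_all _ hBt_bdd)
  -- pointwise identification of the integrands through `T`
  have hin : ((N : ℝ) + 1)⁻¹ * Real.sqrt ((N : ℝ) + 1) = (Real.sqrt ((N : ℝ) + 1))⁻¹ := by
    have hss : Real.sqrt ((N : ℝ) + 1) * Real.sqrt ((N : ℝ) + 1) = (N : ℝ) + 1 := Real.mul_self_sqrt hn0.le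
    calc ((N : ℝ) + 1)⁻¹ * Real.sqrt ((N : ℝ) + 1)
        = (Real.sqrt ((N : ℝ) + 1) * Real.sqrt ((N : ℝ) + 1))⁻¹ * Real.sqrt ((N : ℝ) + 1) := by rw [hss]
      _ = (Real.sqrt ((N : ℝ) + 1))⁻¹ := by rw [mul_inv, mul_assoc, inv_mul_cancel₀ hsq.ne', mul_one]
  have hP : ∀ w : Fin (N + 1) → V3, ∑ i, w i = Real.sqrt ((N : ℝ) + 1) • (T w).1 := fun w => by
    rw [(hTid w).1, smul_smul, mul_inv_cancel₀ hsq.ne', one_smul]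
  have hΦ : ∀ w : Fin (N + 1) → V3,
      (h (w 0) - (∫ u, h ((((N : ℝ) + 1))⁻¹ • (∑ i, w i) +
          Real.sqrt (((((N : ℝ) + 1))⁻¹ * (∑ i, ‖w i‖ ^ 2) - ‖(((N : ℝ) + 1))⁻¹ • (∑ i, w i)‖ ^ 2) / 3) • u)
          ∂(stdGaussian V3))) * B (∑ i, w i) (∑ i, ‖w i‖ ^ 2) = Φt (T w) := by
    intro w
    obtain ⟨-, h2, h3⟩ := hTid w
    have hnorm : ‖(Real.sqrt ((N : ℝ) + 1))⁻¹ • (T w).1‖ ^ 2 = ((N : ℝ) + 1)⁻¹ * ‖(T w).1‖ ^ 2 := by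
      rw [norm_smul, norm_inv, Real.norm_of_nonneg hsq.le, mul_pow, inv_pow, Real.sq_sqrt hn0.le]
    have hs : Real.sqrt ((((N : ℝ) + 1)⁻¹ * (‖(T w).1‖ ^ 2 + ‖(T w).2.1‖ ^ 2 + ‖(T w).2.2‖ ^ 2) -
        ((N : ℝ) + 1)⁻¹ * ‖(T w).1‖ ^ 2) / 3) =
        a * Real.sqrt ((‖(T w).2.1‖ ^ 2 + ‖(T w).2.2‖ ^ 2) / d) := by
      rw [ha, div_mul_eq_mul_div, ← Real.sqrt_mul (Nat.cast_nonneg N), ← Real.sqrt_div' _ hn0.le]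
      congr 1
      rw [hd]
      field_simp
      ring
    rw [hP w, h3, h2, smul_smul, hin, hnorm, hs, hΦt]
    dsimp only
    simp only [smul_smul, add_assoc]
  have hBW : ∀ w : Fin (N + 1) → V3, B (∑ i, w i) (∑ i, ‖w i‖ ^ 2) = Bt (T w) := by
    intro w
    rw [hP w, (hTid w).2.2, hBt, add_assoc]
  -- the Maxwell–Borel lemma at fixed `c`
  have hcore : ∀ c : V3,
      |∫ p, Φt (c, p) ∂((stdGaussian V3).prod (stdGaussian (EuclideanSpace ℝ (Fin ((N - 1) * finrank ℝ V3)))))| ≤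
        2 * (Ck / d) * ∫ p, Bt (c, p) ∂((stdGaussian V3).prod
          (stdGaussian (EuclideanSpace ℝ (Fin ((N - 1) * finrank ℝ V3))))) := by
    intro c
    have := abs_integral_sub_gaussianAverage_mul_le (E₁ := V3)
      (F := EuclideanSpace ℝ (Fin ((N - 1) * finrank ℝ V3))) hF3
      (g := fun v => h ((Real.sqrt ((N : ℝ) + 1))⁻¹ • c + a • v)) (hh.comp (by fun_prop)) (fun v => hh1 _)
      (ψ := fun q => B (Real.sqrt ((N : ℝ) + 1) • c) (‖c‖ ^ 2 + q))
      (hB.comp (f := fun q : ℝ => (Real.sqrt ((N : ℝ) + 1) • c, ‖c‖ ^ 2 + q)) (by fun_prop))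
      (fun q => hB0 _ _) (C := CB) (fun q => hCB _ _)
    rw [hΦt, hBt]
    exact this
  -- assembly: change variables, Fubini over `c`, integrate the bound
  rw [integral_congr_ae (Eventually.of_forall hΦ), integral_congr_ae (Eventually.of_forall hBW),
    ← integral_map hTm.aemeasurable hΦt_meas.aestronglyMeasurable,
    ← integral_map hTm.aemeasurable hBt_meas.aestronglyMeasurable, hTlaw, integral_prod _ hΦt_int,
    integral_prod _ hBt_int]
  refine abs_integral_le_integral_abs.trans ?_
  refine (integral_mono_of_nonneg (ae_of_all _ fun c => abs_nonneg _)
    (hBt_int.integral_prod_left.const_mul (2 * (Ck / d))) (ae_of_all _ fun c => hcore c)).trans ?_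
  rw [integral_const_mul]
  exact mul_le_mul_of_nonneg_right hconst (integral_nonneg fun c => integral_nonneg fun p => hB0 _ _)

end Summit.AtomisticToContinuum.HydrodynamicLimit.Theorems.AlmostInvariantDuality

end
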